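import Mathlib
import Summits.ResolutionOfSingularities.ResolutionOfSingularities.Theorems.RadicialJungCleanModelsCleanProp44TauTwoRegimeLocal
import HarnessLib

/-!
# Route `RadicialJung`, crux `CleanModels` (stmt-ResolutionOfSingularities-15917), line `Sketch` rev 35, stub 6 `stub_cleanProp44` (X44c):
# X44c off ONE clean-permissible centre without very near points

Seat decomp-res-hand-2 g15 (structural hand), continuation of ✓ `…CleanProp44TauTwoRegimeLocal.lean`
(`exists_isCleanPermissibleSeq_lt_of_two_le_stalkTau_off_point`: one exceptional POINT without very near points).  Here the exceptional
locus is ANY clean-permissible centre: **`exists_isCleanPermissibleSeq_lt_of_two_le_stalkTau_off_centre`** — `X` integral Noetherian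
regular quasi-excellent of dimension `≤ 3`, `char K(X) = p`, the line of `G` clean-regular at every point, `(J, μ)` with `μ ≥ 1`, `ord ≤ μ`,
`V(J)` of codimension `≥ 2`; `Y ⊆ {ord J = μ}` an integral regular centre at every point of which the line of `G` is CLEAN-PERMISSIBLE
(`CleanPermissibleAt`, ✓ `…CleanPermissibleSeq.lean`); suppose (i) `Y` has NO VERY NEAR POINT: for every blowing up `π₁ : X₁ → X` along
`Y`, every closed point `x'` over `Y` with `ord_{x'} J₁ = μ` (near) and embedding dimension `3` has `τ_{x'} ≥ 2`, and (ii) `τ ≥ 2` at every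
closed threefold point of the stratum OFF `Y`.  Then some clean-permissible sequence brings `ord` below `μ` everywhere (X44c's conclusion):
blow up `Y` (✓ `exists_isBlowup`, clean-permissible by hypothesis, ✓ `IsCleanPermissibleSeq.cons`), land in the `τ ≥ 2` regime (over `Y` by
(i), elsewhere ✓ `IsBlowup.stalkTau_controlledTransform_of_not_mem`), apply ✓ `exists_isCleanPermissibleSeq_lt_of_two_le_stalkTau`, compose.
For the clean curve slice (R3) of ✓ `cleanProp44_of_tauOneResidual` this settles the curves `Y` that are clean-permissible as they stand
(no L7b insertion) and whose `τ = 1` points have no very near point over the blowing up of `Y` ([CoP1] Lemma 4.3 (4): over a `τ = 1` point of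
a curve centre the near points form the fibre point of `Γ′`).

* `cleanProp44_of_two_le_stalkTau_off_centre` — the same on the stages of `stub_cleanProp44` (binders verbatim + the centre data).

Honest framing: OURS; nothing here proves (R3), X44c, any case of `CleanModels`, or resolution of singularities in characteristic `p`.
[cite: CossartPiltant2008, Prop. 4.2 (b), Lemma 4.3 (2) (4), Prop. 4.4 (proof, pp. 10–11)] [cite: Piltant2013, §2 Axiom 4]
-/

noncomputable section

set_option linter.dupNamespace false -- mandated namespace of this single-conjunct summit

open CategoryTheory CategoryTheory.Limits AlgebraicGeometry TopologicalSpace IsLocalRing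
open Literature.AlgebraicGeometry.Resolution Literature.AlgebraicGeometry.Motives
open Scheme.IdealSheafData
open Summit.ResolutionOfSingularities.ResolutionOfSingularities.Theorems.CP2008Prop44

namespace Summit.ResolutionOfSingularities.ResolutionOfSingularities.Theorems.RadicialJung.CleanModels

/-- For a point with regular local ring: embedding dimension `3` iff coheight `3`. [folklore] -/
private theorem spanFinrank_eq_three_iff_coheight_three {X : Scheme.{0}} (x : X) [IsRegularLocalRing (X.presheaf.stalk x)] :
    (maximalIdeal (X.presheaf.stalk x)).spanFinrank = 3 ↔ Order.coheight x = 3 := by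
  have h := CampaignW46.coheight_eq_spanFinrank x
  constructor
  · intro hd
    rw [h, hd]
    rfl
  · intro hc
    rw [hc] at h
    exact_mod_cast h.symm

set_option maxHeartbeats 800000 in
-- near-point bookkeeping at the new stage
/-- **X44c's conclusion off ONE clean-permissible centre without very near points** (stage-free currency).  See the module docstring.
[cite: CossartPiltant2008, Prop. 4.2 (b), Lemma 4.3, Prop. 4.4 (proof, pp. 10–11)] [cite: Piltant2013, §2 Axiom 4] -/
theorem exists_isCleanPermissibleSeq_lt_of_two_le_stalkTau_off_centre {p : ℕ} (hp : p.Prime) {X : Scheme.{0}} [IsIntegral X]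
    [IsNoetherian X] [hcharX : CharP X.functionField p] (hX : Scheme.IsRegular X) (hqe : Scheme.IsQuasiExcellent X)
    (hX3 : topologicalKrullDim X ≤ 3) (G : X.functionField)
    (hG : ∀ x : X, CleanRegAt p (algebraMap (X.presheaf.stalk x) X.functionField) G)
    (J : X.IdealSheafData) {μ : ℕ} (hμ : 1 ≤ μ) (hle : ∀ z, idealOrder J z ≤ μ) (hcodim : ∀ z ∈ J.support, 1 < Order.coheight z)
    (Y : Closeds X) (hYint : IsIntegral (vanishingIdeal Y).subscheme) (hYreg : Scheme.IsRegular (vanishingIdeal Y).subscheme)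
    (hYord : ∀ y ∈ (Y : Set X), idealOrder J y = μ)
    (hperm : ∀ y ∈ (Y : Set X), CleanPermissibleAt p (algebraMap (X.presheaf.stalk y) X.functionField) G (stalkIdeal (vanishingIdeal Y) y))
    (hvn : ∀ (X₁ : Scheme.{0}) (π₁ : X₁ ⟶ X), IsBlowup π₁ (vanishingIdeal Y) →
      ∀ x' : X₁, IsClosed ({x'} : Set X₁) → π₁ x' ∈ (Y : Set X) →
        idealOrder (controlledTransform π₁ (vanishingIdeal Y) J μ) x' = μ →
        (maximalIdeal (X₁.presheaf.stalk x')).spanFinrank = 3 →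
        ∀ hr : IsRegularLocalRing (X₁.presheaf.stalk x'), 2 ≤ @stalkTau X₁ (controlledTransform π₁ (vanishingIdeal Y) J μ) x' hr μ)
    (hτ2 : ∀ x : X, x ∉ (Y : Set X) → IsClosed ({x} : Set X) → idealOrder J x = μ →
      (maximalIdeal (X.presheaf.stalk x)).spanFinrank = 3 → ∀ hr : IsRegularLocalRing (X.presheaf.stalk x), 2 ≤ @stalkTau X J x hr μ) :
    ∃ (X' : Scheme.{0}) (π : X' ⟶ X) (_ : IsIntegral X') (_ : IsDominant π) (J' : X'.IdealSheafData),
      IsCleanPermissibleSeq p π J μ J' G ∧ ∀ x, idealOrder J' x < μ := by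
  -- the blowing up along `Y`
  obtain ⟨X₁, π₁, hπ₁⟩ := exists_isBlowup X (vanishingIdeal Y)
  have hJne : J ≠ ⊥ := ne_bot_of_forall_one_lt_coheight hcodim
  have hYne : vanishingIdeal Y ≠ ⊥ := vanishingIdeal_ne_bot_of_forall_idealOrder_eq hJne hμ hYord
  haveI : IsIntegral X₁ := hπ₁.isIntegral hYne
  haveI : IsDominant π₁ := isDominant_of_isBlowup_of_ne_bot hπ₁ hYne
  haveI : IsProper π₁ := hπ₁.isProper
  haveI : IsLocallyNoetherian X₁ := hπ₁.isLocallyNoetherian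
  -- the one-step clean-permissible sequence
  have hseq₁ : IsCleanPermissibleSeq p (π₁ ≫ 𝟙 X) J μ (controlledTransform π₁ (vanishingIdeal Y) J μ) G :=
    IsCleanPermissibleSeq.cons π₁ (𝟙 X) J μ J G Y (IsCleanPermissibleSeq.nil J μ G) hYint hYreg hYord hπ₁
      (fun y hy => by rw [RatFn.functionFieldMap_id]; exact hperm y hy)
  have hseq₁' : IsCleanPermissibleSeq p π₁ J μ (controlledTransform π₁ (vanishingIdeal Y) J μ) G := by
    simpa only [Category.comp_id] using hseq₁
  set J₁ := controlledTransform π₁ (vanishingIdeal Y) J μ with hJ₁def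
  -- the invariants at the new stage
  have hseqW : CampaignW46.IsPermissibleBlowupSeq J μ π₁ J₁ :=
    CP2008Prop44.isPermissibleBlowupSeq_of_isPermissibleSeq hseq₁'.isPermissibleSeq
  obtain ⟨-, hnoeth₁, hX₁, hqe₁, hle₁, hcodim₁⟩ := IsPermissibleBlowupSeq.prop44Invariants hX hqe hμ hle hcodim hseqW
  haveI := hnoeth₁
  have hX3₁ : topologicalKrullDim X₁ ≤ 3 := hseqW.topologicalKrullDim_le inferInstance hX3
  haveI hcharX₁ : CharP X₁.functionField p := charP_of_injective_ringHom (RatFn.functionFieldMap π₁).injective p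
  have hG₁ : ∀ x : X₁, CleanRegAt p (algebraMap (X₁.presheaf.stalk x) X₁.functionField) (RatFn.functionFieldMap π₁ G) :=
    hseq₁'.cleanRegAt hp hcharX hG
  -- the new stage is in the `τ ≥ 2` regime
  have hτ2₁ : ∀ x' : X₁, IsClosed ({x'} : Set X₁) → idealOrder J₁ x' = μ → (maximalIdeal (X₁.presheaf.stalk x')).spanFinrank = 3 →
      ∀ hr : IsRegularLocalRing (X₁.presheaf.stalk x'), 2 ≤ @stalkTau X₁ J₁ x' hr μ := by
    intro x' hx'cl hord' hd' hr'
    by_cases hover : π₁ x' ∈ (Y : Set X)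
    · -- a near point over `Y`: hypothesis `hvn`
      exact hvn X₁ π₁ hπ₁ x' hx'cl hover hord' hd' hr'
    · -- off the centre: the local ring, the order and `τ` are those of the image point
      haveI hry : IsRegularLocalRing (X.presheaf.stalk (π₁ x')) := hX (π₁ x')
      have hycl : IsClosed ({π₁ x'} : Set X) := by
        have := π₁.isClosedMap _ hx'cl
        rwa [Set.image_singleton] at this
      have hcohx' : Order.coheight x' = 3 := (spanFinrank_eq_three_iff_coheight_three x').mp hd'
      have hcoh3 : ∀ z : X, Order.coheight z ≤ 3 := (topologicalKrullDim_le_iff_forall_coheight_le X 3).mp hX3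
      have hcohy : Order.coheight (π₁ x') = 3 := le_antisymm (hcoh3 _) (hcohx' ▸ hπ₁.coheight_le x')
      have hdy : (maximalIdeal (X.presheaf.stalk (π₁ x'))).spanFinrank = 3 := (spanFinrank_eq_three_iff_coheight_three _).mpr hcohy
      have hnot : π₁ x' ∉ ((vanishingIdeal Y).support : Set X) := by
        rw [Scheme.IdealSheafData.coe_support_vanishingIdeal]
        exact hover
      have hτeq := hπ₁.stalkTau_controlledTransform_of_not_mem J μ μ hnot (x' := x')
      have hordeq := hπ₁.idealOrder_controlledTransform_of_not_mem J μ hnot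
      rw [hJ₁def, hτeq]
      rw [hJ₁def, hordeq] at hord'
      exact hτ2 (π₁ x') hover hycl hord' hdy hry
  -- the regime theorem at the new stage, composed with the first blowing up
  obtain ⟨X', π', hX', hπ', J', hseq', hlt⟩ :=
    exists_isCleanPermissibleSeq_lt_of_two_le_stalkTau hp hX₁ hqe₁ hX3₁ (RatFn.functionFieldMap π₁ G) hG₁ J₁ hμ hle₁ hcodim₁ hτ2₁
  haveI := hX'
  haveI := hπ'
  exact ⟨X', π' ≫ π₁, inferInstance, inferInstance, J', hseq₁'.comp hseq' rfl, hlt⟩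

set_option maxHeartbeats 800000 in
-- long binder list
/-- **X44c (`stub_cleanProp44`) off ONE clean-permissible centre without very near points.**  The binders of `stub_cleanProp44` VERBATIM,
plus an integral regular centre `Y ⊆ {ord J = μ}` of the stage at whose points the line of `ρ^♯ G₀` is clean-permissible, with no very near
point (hypothesis `hvn` of `exists_isCleanPermissibleSeq_lt_of_two_le_stalkTau_off_centre`), and `τ ≥ 2` at every closed threefold point of the
`μ`-stratum off `Y`.  Conclusion: the conclusion of `stub_cleanProp44` verbatim. [cite: CossartPiltant2008, Prop. 4.4] [cite: Piltant2013, §2 Axiom 4] -/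
theorem cleanProp44_of_two_le_stalkTau_off_centre :
    ∀ (p : ℕ), p.Prime → ∀ (S : Scheme.{0}) [IsIntegral S] [IsNoetherian S],
      CharP S.functionField p → Scheme.IsRegular S → Scheme.IsExcellent S → topologicalKrullDim S = 3 →
      ∀ G₀ : S.functionField, (∀ s : S, CleanRegAt p (algebraMap (S.presheaf.stalk s) S.functionField) G₀) →
      ∀ I : S.IdealSheafData, I ≠ ⊥ →
      ∀ (X : Scheme.{0}) (ρ : X ⟶ S) [IsIntegral X] [IsNoetherian X] [IsDominant ρ],
        IsCleanRegularCentreBlowupSeq p ρ I G₀ →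
        (∀ x : X, CleanRegAt p (algebraMap (X.presheaf.stalk x) X.functionField) (RatFn.functionFieldMap ρ G₀)) →
        ∀ (J : X.IdealSheafData) (μ : ℕ), 1 ≤ μ →
          (∀ x ∈ J.support, 1 < Order.coheight x) → (∀ x, idealOrder J x ≤ μ) → (∃ x, idealOrder J x = μ) →
          ∀ (Y : Closeds X), IsIntegral (vanishingIdeal Y).subscheme → Scheme.IsRegular (vanishingIdeal Y).subscheme →
          (∀ y ∈ (Y : Set X), idealOrder J y = μ) →
          (∀ y ∈ (Y : Set X), CleanPermissibleAt p (algebraMap (X.presheaf.stalk y) X.functionField) (RatFn.functionFieldMap ρ G₀)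
            (stalkIdeal (vanishingIdeal Y) y)) →
          (∀ (X₁ : Scheme.{0}) (π₁ : X₁ ⟶ X), IsBlowup π₁ (vanishingIdeal Y) →
            ∀ x' : X₁, IsClosed ({x'} : Set X₁) → π₁ x' ∈ (Y : Set X) →
              idealOrder (controlledTransform π₁ (vanishingIdeal Y) J μ) x' = μ →
              (maximalIdeal (X₁.presheaf.stalk x')).spanFinrank = 3 →
              ∀ hr : IsRegularLocalRing (X₁.presheaf.stalk x'),
                2 ≤ @stalkTau X₁ (controlledTransform π₁ (vanishingIdeal Y) J μ) x' hr μ) →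
          (∀ x : X, x ∉ (Y : Set X) → IsClosed ({x} : Set X) → idealOrder J x = μ →
            (maximalIdeal (X.presheaf.stalk x)).spanFinrank = 3 → ∀ hr : IsRegularLocalRing (X.presheaf.stalk x), 2 ≤ @stalkTau X J x hr μ) →
          ∃ (X' : Scheme.{0}) (π : X' ⟶ X) (_ : IsIntegral X') (_ : IsDominant π) (J' : X'.IdealSheafData),
            IsCleanPermissibleSeq p π J μ J' (RatFn.functionFieldMap ρ G₀) ∧ ∀ x, idealOrder J' x < μ := by
  intro p hp S _ _ hchar hS hexc hdimS G₀ _ I _ X ρ _ _ _ hρ hG J μ hμ hcodim hle _ Y hYint hYreg hYord hperm hvn hτ2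
  have hρ' : IsRegularCentreBlowupSeq ρ I := hρ.isRegularCentreBlowupSeq
  have hX : Scheme.IsRegular X := hρ'.isRegular hS
  have hqe : Scheme.IsQuasiExcellent X := hρ'.isQuasiExcellent hexc
  have hX3 : topologicalKrullDim X ≤ 3 := CP2008Prop44.topologicalKrullDim_stage_le hρ' inferInstance (n := 3) hdimS.le
  haveI hcharX : CharP X.functionField p := charP_of_injective_ringHom (RatFn.functionFieldMap ρ).injective p
  exact exists_isCleanPermissibleSeq_lt_of_two_le_stalkTau_off_centre hp hX hqe hX3 (RatFn.functionFieldMap ρ G₀) hG J hμ hle hcodim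
    Y hYint hYreg hYord hperm hvn hτ2

end Summit.ResolutionOfSingularities.ResolutionOfSingularities.Theorems.RadicialJung.CleanModels

end
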